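import Mathlib
import HarnessLib
import Literature.Algebra.EuclideanLattices.FccBccLattices
import Summits.AtomisticToContinuum.Crystallization.Theorems.PricedLinkCensusSoftLayerPropagationStubMetricDet
import Summits.AtomisticToContinuum.Crystallization.Theorems.PricedLinkCensusSoftLayerPropagationStubMetricScaled
import Summits.AtomisticToContinuum.Crystallization.Theorems.PricedLinkCensusSoftLayerPropagationHXLensB

/-!
# No common neighbour of a vertical pair outside the star (crux `SoftLayerPropagation`, line `Sketch`)

Route `PricedLinkCensus`, crux `SoftLayerPropagation` (stmt-AtomisticToContinuum-14233), line
`Sketch`, helper file for the stub `develop_HX_hcp` (local no-merge at an HCP-type site, VERTICAL-PAIR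
case `|p_u − p_k|² = 8/3`): registered sub-goal `hxh_lens_vertical`.

**The lens lemma for a vertical pair (unit scale).**  Let `u, k` be the two apices of a contact
bipyramid on the face `x b c` (so `‖u − k‖²` lies in the window
`[8/3 − 4α/3 − 27α², 8/3 + 4α]`, `α = 13/200`, of `Theorems.metric_bipyramid`), and let `t` be a
fourth point which, like `x, b, c`, has its squared distances to `u` and to `k` in `[1, 1 + 13/200]`,
while the six mutual squared distances of `x, b, c, t` are `≥ 1`.  Then: contradiction.

Proof.  With `n = u − k` and `V_v = (v − u) + (v − k)` for `v ∈ {x, b, c, t}`: polarisation gives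
`|⟪V_v, n⟫| ≤ 13/200` (the four vectors are nearly orthogonal to the axis) and
`⟪V_v, V_w⟫ ≤ 2 + 4·13/200 − ‖n‖² < −1/5` (pairwise obtuse).  Four pairwise obtuse vectors do not
fit into a plane: among the three signed volumes `det(V_v, n, V_x)`, `v = b, c, t`, two have a
non-negative product (pigeonhole), whereas the product formula `det·det = det(⟪·,·⟫)`
(`det3_mul_det3`) makes every such product `≤ −0.2·(‖n‖² ‖V_x‖²) + O(13/200) < 0`.
The distance form at scale `ℓ` (`hxh_lens_vertical_dist`) is what `develop_HX_hcp` consumes.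
All `[folklore]`.
-/

noncomputable section

namespace Summit.AtomisticToContinuum.Crystallization.Theorems

open Literature.Geometry.DiscreteGeometry

/-- Polarisation bookkeeping for the vertical lens lemma: the vector `V_v = (v − u) + (v − k)` against
the axis `u − k` and against `V_w`. [folklore] -/
theorem vertical_identities (u k v w : EuclideanSpace ℝ (Fin 3)) :
    ‖v - u + (v - k)‖ ^ 2 = 2 * ‖v - u‖ ^ 2 + 2 * ‖v - k‖ ^ 2 - ‖u - k‖ ^ 2 ∧
    inner ℝ (v - u + (v - k)) (u - k) = ‖v - k‖ ^ 2 - ‖v - u‖ ^ 2 ∧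
    inner ℝ (v - u + (v - k)) (w - u + (w - k)) =
      ‖v - u‖ ^ 2 + ‖v - k‖ ^ 2 + ‖w - u‖ ^ 2 + ‖w - k‖ ^ 2 - ‖u - k‖ ^ 2 - 2 * ‖v - w‖ ^ 2 := by
  simp only [Literature.Algebra.EuclideanLattices.inner_fin_three,
    Literature.Algebra.EuclideanLattices.norm_sq_fin_three, PiLp.add_apply, PiLp.sub_apply]
  refine ⟨by ring, by ring, by ring⟩

/-- **Two obtuse near-coplanar vectors on the same side.**  If `V, W, E` are pairwise obtuse
(`⟪·,·⟫ ≤ −2059/10000`), all three nearly orthogonal to `n` (`|⟪·, n⟫| ≤ 13/200`), with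
`‖n‖² ≥ 2465/1000`, `‖E‖² ≥ 1073/1000` and the three squared norms `≤ 9/5`, then the signed volumes
`det(V, n, E)` and `det(W, n, E)` have a negative product. [folklore] -/
theorem vertical_pair_kill (V W E n : EuclideanSpace ℝ (Fin 3))
    (hVW : inner ℝ V W ≤ -(2059 / 10000)) (hVE : inner ℝ V E ≤ -(2059 / 10000))
    (hWE : inner ℝ W E ≤ -(2059 / 10000))
    (hVn : |inner ℝ V n| ≤ 13 / 200) (hWn : |inner ℝ W n| ≤ 13 / 200) (hEn : |inner ℝ E n| ≤ 13 / 200)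
    (hn : 2465 / 1000 ≤ ‖n‖ ^ 2) (hE : 1073 / 1000 ≤ ‖E‖ ^ 2)
    (hV' : ‖V‖ ^ 2 ≤ 9 / 5) (hW' : ‖W‖ ^ 2 ≤ 9 / 5) (hE' : ‖E‖ ^ 2 ≤ 9 / 5) :
    Matrix.det ![WithLp.ofLp V, WithLp.ofLp n, WithLp.ofLp E] *
      Matrix.det ![WithLp.ofLp W, WithLp.ofLp n, WithLp.ofLp E] < 0 := by
  have amul : ∀ {a b A B : ℝ}, |a| ≤ A → |b| ≤ B → |a * b| ≤ A * B :=
    fun ha hb => by rw [abs_mul]; exact mul_le_mul ha hb (abs_nonneg _) ((abs_nonneg _).trans ha)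
  have sq3 : ∀ {v : EuclideanSpace ℝ (Fin 3)}, ‖v‖ ^ 2 ≤ 9 / 5 → ‖v‖ ≤ 3 / 2 := fun h =>
    (pow_le_pow_iff_left₀ (norm_nonneg _) (by norm_num) two_ne_zero).1 (h.trans (by norm_num))
  rw [det3_mul_det3, real_inner_comm W n, real_inner_comm E n, real_inner_comm W E,
    real_inner_self_eq_norm_sq, real_inner_self_eq_norm_sq]
  -- sizes of the inner products with `E`
  have cVE : |inner ℝ V E| ≤ 9 / 4 :=
    (abs_real_inner_le_norm V E).trans
      ((mul_le_mul (sq3 hV') (sq3 hE') (norm_nonneg _) (by norm_num)).trans (by norm_num))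
  have cWE : |inner ℝ W E| ≤ 9 / 4 :=
    (abs_real_inner_le_norm W E).trans
      ((mul_le_mul (sq3 hW') (sq3 hE') (norm_nonneg _) (by norm_num)).trans (by norm_num))
  have NE : |‖E‖ ^ 2| ≤ 9 / 5 := by rw [abs_of_nonneg (sq_nonneg _)]; exact hE'
  -- the main term
  have hEn2 : inner ℝ E n * inner ℝ E n ≤ 13 / 200 * (13 / 200) := by
    have := amul hEn hEn
    rw [abs_le] at this
    exact this.2
  have hnE : 2465 / 1000 * (1073 / 1000) ≤ ‖n‖ ^ 2 * ‖E‖ ^ 2 :=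
    mul_le_mul hn hE (by norm_num) (sq_nonneg _)
  have base : 264 / 100 ≤ ‖n‖ ^ 2 * ‖E‖ ^ 2 - inner ℝ E n * inner ℝ E n := by
    linarith only [hEn2, hnE]
  have t1a : inner ℝ V W * (‖n‖ ^ 2 * ‖E‖ ^ 2 - inner ℝ E n * inner ℝ E n) ≤
      -(2059 / 10000) * (‖n‖ ^ 2 * ‖E‖ ^ 2 - inner ℝ E n * inner ℝ E n) :=
    mul_le_mul_of_nonneg_right hVW (by linarith only [base])
  have t1 : inner ℝ V W * (‖n‖ ^ 2 * ‖E‖ ^ 2 - inner ℝ E n * inner ℝ E n) ≤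
      -(2059 / 10000) * (264 / 100) := by linarith only [t1a, base]
  -- the two small terms
  have t2 : |inner ℝ V n * (inner ℝ W n * ‖E‖ ^ 2 - inner ℝ E n * inner ℝ W E)| ≤
      13 / 200 * (13 / 200 * (9 / 5) + 13 / 200 * (9 / 4)) :=
    amul hVn ((abs_sub _ _).trans (add_le_add (amul hWn NE) (amul hEn cWE)))
  have t3 : |inner ℝ V E * (inner ℝ W n * inner ℝ E n)| ≤ 9 / 4 * (13 / 200 * (13 / 200)) :=
    amul cVE (amul hWn hEn)
  -- the last term is negative
  have t4a : -(2059 / 10000) * inner ℝ W E ≤ inner ℝ V E * inner ℝ W E :=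
    mul_le_mul_of_nonpos_right hVE (by linarith only [hWE])
  have t4 : 2059 / 10000 * (2059 / 10000) ≤ inner ℝ V E * inner ℝ W E := by linarith only [t4a, hWE]
  have t4' : 2465 / 1000 * (2059 / 10000 * (2059 / 10000)) ≤ ‖n‖ ^ 2 * (inner ℝ V E * inner ℝ W E) :=
    mul_le_mul hn t4 (by norm_num) (sq_nonneg _)
  have h2 := (abs_le.1 t2).1
  have h3 := (abs_le.1 t3).2
  have expand : inner ℝ V W * (‖n‖ ^ 2 * ‖E‖ ^ 2 - inner ℝ E n * inner ℝ E n) -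
      inner ℝ V n * (inner ℝ W n * ‖E‖ ^ 2 - inner ℝ E n * inner ℝ W E) +
      inner ℝ V E * (inner ℝ W n * inner ℝ E n - ‖n‖ ^ 2 * inner ℝ W E) =
      inner ℝ V W * (‖n‖ ^ 2 * ‖E‖ ^ 2 - inner ℝ E n * inner ℝ E n) -
      inner ℝ V n * (inner ℝ W n * ‖E‖ ^ 2 - inner ℝ E n * inner ℝ W E) +
      inner ℝ V E * (inner ℝ W n * inner ℝ E n) - ‖n‖ ^ 2 * (inner ℝ V E * inner ℝ W E) := by ring
  rw [expand]
  linarith only [t1, h2, h3, t4']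

set_option maxHeartbeats 800000 in
/-- **Registered sub-goal `hxh_lens_vertical`: the lens lemma for a vertical pair, unit scale.**
Apices `u, k` with `‖u − k‖²` in the bipyramid window at `α = 13/200`; four points `x, b, c, t` with
squared distances to `u` and to `k` in `[1, 1 + 13/200]` and the six mutual squared distances `≥ 1`:
impossible. [folklore] -/
theorem hxh_lens_vertical : ∀ (u k x b c t : EuclideanSpace ℝ (Fin 3)), 1 ≤ ‖x - u‖ ^ 2 → ‖x - u‖ ^ 2 ≤ 1 + 13 / 200 → 1 ≤ ‖x - k‖ ^ 2 → ‖x - k‖ ^ 2 ≤ 1 + 13 / 200 → 1 ≤ ‖b - u‖ ^ 2 → ‖b - u‖ ^ 2 ≤ 1 + 13 / 200 → 1 ≤ ‖b - k‖ ^ 2 → ‖b - k‖ ^ 2 ≤ 1 + 13 / 200 → 1 ≤ ‖c - u‖ ^ 2 → ‖c - u‖ ^ 2 ≤ 1 + 13 / 200 → 1 ≤ ‖c - k‖ ^ 2 → ‖c - k‖ ^ 2 ≤ 1 + 13 / 200 → 1 ≤ ‖t - u‖ ^ 2 → ‖t - u‖ ^ 2 ≤ 1 + 13 / 200 → 1 ≤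 ‖t - k‖ ^ 2 → ‖t - k‖ ^ 2 ≤ 1 + 13 / 200 → 8 / 3 - 4 / 3 * (13 / 200) - 27 * (13 / 200) ^ 2 ≤ ‖u - k‖ ^ 2 → ‖u - k‖ ^ 2 ≤ 8 / 3 + 4 * (13 / 200) → 1 ≤ ‖x - b‖ ^ 2 → 1 ≤ ‖x - c‖ ^ 2 → 1 ≤ ‖b - c‖ ^ 2 → 1 ≤ ‖t - x‖ ^ 2 → 1 ≤ ‖t - b‖ ^ 2 → 1 ≤ ‖t - c‖ ^ 2 → False := by
  intro u k x b c t hxu hxu' hxk hxk' hbu hbu' hbk hbk' hcu hcu' hck hck' htu htu' htk htk' hM hM'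
    hxb hxc hbc htx htb htc
  -- the identities
  obtain ⟨nX, aX, -⟩ := vertical_identities u k x x
  obtain ⟨nB, aB, -⟩ := vertical_identities u k b b
  obtain ⟨nC, aC, -⟩ := vertical_identities u k c c
  obtain ⟨nT, aT, -⟩ := vertical_identities u k t t
  obtain ⟨-, -, iBX⟩ := vertical_identities u k b x
  obtain ⟨-, -, iCX⟩ := vertical_identities u k c x
  obtain ⟨-, -, iTX⟩ := vertical_identities u k t x
  obtain ⟨-, -, iBC⟩ := vertical_identities u k b c
  obtain ⟨-, -, iBT⟩ := vertical_identities u k b t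
  obtain ⟨-, -, iCT⟩ := vertical_identities u k c t
  generalize hX : x - u + (x - k) = X at *
  generalize hB : b - u + (b - k) = B at *
  generalize hC : c - u + (c - k) = C at *
  generalize hT : t - u + (t - k) = T at *
  generalize hn : u - k = n at *
  norm_num at hM hM'
  rw [norm_sub_rev x b, norm_sub_rev x c] at *
  rw [norm_sub_rev b t] at iBT
  rw [norm_sub_rev c t] at iCT
  -- numerical windows
  have Mlo : 2465 / 1000 ≤ ‖n‖ ^ 2 := by linarith only [hM]
  have NX : 1073 / 1000 ≤ ‖X‖ ^ 2 := by rw [nX]; linarith only [hxu, hxk, hM']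
  have NX' : ‖X‖ ^ 2 ≤ 9 / 5 := by rw [nX]; linarith only [hxu', hxk', hM]
  have NB' : ‖B‖ ^ 2 ≤ 9 / 5 := by rw [nB]; linarith only [hbu', hbk', hM]
  have NC' : ‖C‖ ^ 2 ≤ 9 / 5 := by rw [nC]; linarith only [hcu', hck', hM]
  have NT' : ‖T‖ ^ 2 ≤ 9 / 5 := by rw [nT]; linarith only [htu', htk', hM]
  have AX : |inner ℝ X n| ≤ 13 / 200 := by
    rw [aX]; exact abs_le.2 ⟨by linarith only [hxk, hxu'], by linarith only [hxk', hxu]⟩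
  have AB : |inner ℝ B n| ≤ 13 / 200 := by
    rw [aB]; exact abs_le.2 ⟨by linarith only [hbk, hbu'], by linarith only [hbk', hbu]⟩
  have AC : |inner ℝ C n| ≤ 13 / 200 := by
    rw [aC]; exact abs_le.2 ⟨by linarith only [hck, hcu'], by linarith only [hck', hcu]⟩
  have AT : |inner ℝ T n| ≤ 13 / 200 := by
    rw [aT]; exact abs_le.2 ⟨by linarith only [htk, htu'], by linarith only [htk', htu]⟩
  have oBX : inner ℝ B X ≤ -(2059 / 10000) := by
    rw [iBX]; linarith only [hbu', hbk', hxu', hxk', hM, hxb]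
  have oCX : inner ℝ C X ≤ -(2059 / 10000) := by
    rw [iCX]; linarith only [hcu', hck', hxu', hxk', hM, hxc]
  have oTX : inner ℝ T X ≤ -(2059 / 10000) := by
    rw [iTX]; linarith only [htu', htk', hxu', hxk', hM, htx]
  have oBC : inner ℝ B C ≤ -(2059 / 10000) := by
    rw [iBC]; linarith only [hbu', hbk', hcu', hck', hM, hbc]
  have oBT : inner ℝ B T ≤ -(2059 / 10000) := by
    rw [iBT]; linarith only [hbu', hbk', htu', htk', hM, htb]
  have oCT : inner ℝ C T ≤ -(2059 / 10000) := by
    rw [iCT]; linarith only [hcu', hck', htu', htk', hM, htc]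
  -- the three pair kills
  have kBC := vertical_pair_kill B C X n oBC oBX oCX AB AC AX Mlo NX NB' NC' NX'
  have kBT := vertical_pair_kill B T X n oBT oBX oTX AB AT AX Mlo NX NB' NT' NX'
  have kCT := vertical_pair_kill C T X n oCT oCX oTX AC AT AX Mlo NX NC' NT' NX'
  -- pigeonhole on the signs of the three volumes
  generalize hdB : Matrix.det ![WithLp.ofLp B, WithLp.ofLp n, WithLp.ofLp X] = dB at *
  generalize hdC : Matrix.det ![WithLp.ofLp C, WithLp.ofLp n, WithLp.ofLp X] = dC at *
  generalize hdT : Matrix.det ![WithLp.ofLp T, WithLp.ofLp n, WithLp.ofLp X] = dT at *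
  have key : 0 < (dB * dC) * (dB * dT) := mul_pos_of_neg_of_neg kBC kBT
  have key' : (dB * dC) * (dB * dT) = dB ^ 2 * (dC * dT) := by ring
  rw [key'] at key
  nlinarith [sq_nonneg dB, kCT]

/-- The bipyramid apex window shrinks with the tolerance: for `α = 2ε + ε²`, `ε ≤ 1/32`, the window
`[(8/3 − 4α/3 − 27α²)ℓ², (8/3 + 4α)ℓ²]` lies inside the unit window at `α = 13/200` after rescaling.
[folklore] -/
theorem vert_window_rescale {ℓ ε : ℝ} (hℓ : 0 < ℓ) (hε : 0 ≤ ε) (hε' : ε ≤ 1 / 32)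
    {p q : EuclideanSpace ℝ (Fin 3)}
    (h₁ : (8 / 3 - 4 / 3 * (2 * ε + ε ^ 2) - 27 * (2 * ε + ε ^ 2) ^ 2) * ℓ ^ 2 ≤ dist p q ^ 2)
    (h₂ : dist p q ^ 2 ≤ (8 / 3 + 4 * (2 * ε + ε ^ 2)) * ℓ ^ 2) :
    8 / 3 - 4 / 3 * (13 / 200) - 27 * (13 / 200) ^ 2 ≤ ‖ℓ⁻¹ • p - ℓ⁻¹ • q‖ ^ 2 ∧
      ‖ℓ⁻¹ • p - ℓ⁻¹ • q‖ ^ 2 ≤ 8 / 3 + 4 * (13 / 200) := by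
  have hℓ2 : (0 : ℝ) < ℓ ^ 2 := by positivity
  have hα : 2 * ε + ε ^ 2 ≤ 13 / 200 := by nlinarith
  have hα0 : 0 ≤ 2 * ε + ε ^ 2 := by positivity
  rw [norm_inv_smul_sub_sq hℓ]
  constructor
  · rw [le_div_iff₀ hℓ2]
    refine le_trans ?_ h₁
    apply mul_le_mul_of_nonneg_right _ hℓ2.le
    nlinarith
  · rw [div_le_iff₀ hℓ2]
    refine h₂.trans ?_
    apply mul_le_mul_of_nonneg_right _ hℓ2.le
    linarith

/-- **The lens lemma for a vertical pair at scale `ℓ`, distance form.**  Apices `u, k` of a contact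
bipyramid on the face `x b c` (so `dist u k ²` lies in the window of `Theorems.metric_bipyramid_dist`,
`α = 2ε + ε²`, `ε ≤ 1/32`), the eight distances from `x, b, c, t` to `u, k` in `[ℓ, (1+ε)ℓ]`, and the six
mutual distances of `x, b, c, t` at least `ℓ`: impossible. [folklore] -/
theorem hxh_lens_vertical_dist : ∀ ε ℓ : ℝ, 0 ≤ ε → ε ≤ 1 / 32 → 0 < ℓ →
    ∀ (u k x b c t : EuclideanSpace ℝ (Fin 3)),
      ℓ ≤ dist x u → dist x u ≤ (1 + ε) * ℓ → ℓ ≤ dist x k → dist x k ≤ (1 + ε) * ℓ →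
      ℓ ≤ dist b u → dist b u ≤ (1 + ε) * ℓ → ℓ ≤ dist b k → dist b k ≤ (1 + ε) * ℓ →
      ℓ ≤ dist c u → dist c u ≤ (1 + ε) * ℓ → ℓ ≤ dist c k → dist c k ≤ (1 + ε) * ℓ →
      ℓ ≤ dist t u → dist t u ≤ (1 + ε) * ℓ → ℓ ≤ dist t k → dist t k ≤ (1 + ε) * ℓ →
      (8 / 3 - 4 / 3 * (2 * ε + ε ^ 2) - 27 * (2 * ε + ε ^ 2) ^ 2) * ℓ ^ 2 ≤ dist u k ^ 2 →
      dist u k ^ 2 ≤ (8 / 3 + 4 * (2 * ε + ε ^ 2)) * ℓ ^ 2 →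
      ℓ ≤ dist x b → ℓ ≤ dist x c → ℓ ≤ dist b c → ℓ ≤ dist t x → ℓ ≤ dist t b → ℓ ≤ dist t c →
      False := by
  intro ε ℓ hε hε' hℓ u k x b c t hxu hxu' hxk hxk' hbu hbu' hbk hbk' hcu hcu' hck hck' htu htu'
    htk htk' hM hM' hxb hxc hbc htx htb htc
  have W := fun {p q : EuclideanSpace ℝ (Fin 3)} (h₁ : ℓ ≤ dist p q) (h₂ : dist p q ≤ (1 + ε) * ℓ) =>
    window_rescale_13 hℓ hε hε' h₁ h₂
  have F := fun {p q : EuclideanSpace ℝ (Fin 3)} (h₁ : ℓ ≤ dist p q) => floor_rescale hℓ h₁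
  obtain ⟨mlo, mhi⟩ := vert_window_rescale hℓ hε hε' hM hM'
  exact hxh_lens_vertical (ℓ⁻¹ • u) (ℓ⁻¹ • k) (ℓ⁻¹ • x) (ℓ⁻¹ • b) (ℓ⁻¹ • c) (ℓ⁻¹ • t)
    (W hxu hxu').1 (W hxu hxu').2 (W hxk hxk').1 (W hxk hxk').2 (W hbu hbu').1 (W hbu hbu').2
    (W hbk hbk').1 (W hbk hbk').2 (W hcu hcu').1 (W hcu hcu').2 (W hck hck').1 (W hck hck').2
    (W htu htu').1 (W htu htu').2 (W htk htk').1 (W htk htk').2 mlo mhi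
    (F hxb) (F hxc) (F hbc) (F htx) (F htb) (F htc)

end Summit.AtomisticToContinuum.Crystallization.Theorems

end
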